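import Literature.Algebra.Polynomial.CasasAlvero.Transfer
import Literature.Algebra.Polynomial.CasasAlvero.Ascent
import Literature.Algebra.Polynomial.CasasAlvero.BadPrimesFinite
import Mathlib.Algebra.Field.ULift
import Mathlib.Algebra.CharP.Basic
import Mathlib.Tactic.TFAE
import HarnessLib

/-!
# Casas-Alvero: [GvBLSW 2007, Prop. 2] assembled — the dichotomy, and the characteristic-`0` conjecture in four
# equivalent forms

`Transfer.lean` (valuation rings: characteristic `p` ⟹ characteristic `0`), `Ascent.lean` (Nullstellensatz: one
algebraically closed field decides a characteristic) and `BadPrimesFinite.lean` (Nullstellensatz over `ℚ` and clearing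
denominators: characteristic `0` ⟹ all but finitely many `p`) are the three arrows of [GvBLSW 2007, Prop. 2].  This
file only assembles them:

* `gvblsw_dichotomy` — for every degree `d`, EITHER `CA_d` fails over every algebraically closed field (of every
  characteristic), OR `CA_d` holds over every field of characteristic `0` and there is `N ≠ 0` such that it holds over
  every field of every prime characteristic `p ∤ N` [GvBLSW 2007, Prop. 2 (a)/(b)];
* `holdsInDegree_charZero_tfae` — for every `d` the following are EQUIVALENT: (1) `CA_d` over every field of
  characteristic `0`; (2) for SOME prime `p`, `CA_d` over every field of characteristic `p`; (3) for some `N ≠ 0`,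
  `CA_d` over every field of every prime characteristic `p ∤ N`; (4) the set of bad primes of degree `d` is finite.
  In particular the Casas-Alvero conjecture in degree `d` (a statement about `ℂ`) is equivalent to a statement
  decidable prime by prime by finite search (`X_d(𝔽̄_p) = ∅` for one `p`), which is how every known case was proved.

(The first alternative is stated for ALGEBRAICALLY CLOSED fields: `HoldsInDegree k d` asks for `k`-rational witnesses,
whereas a `k`-point of the scheme `X_d` of [GvBLSW 2007] is a polynomial over `k` whose witnesses may lie in `k̄`.)
-/

noncomputable section

open Polynomial

namespace Literature.Algebra.Polynomial.CasasAlvero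

universe u

/-- `ULift ℚ` has characteristic `0` (so `AlgebraicClosure (ULift ℚ)` is an algebraically closed field of
characteristic `0` in an arbitrary universe). [folklore] -/
private theorem charZero_uliftRat : CharZero (ULift.{u} ℚ) := by
  haveI : CharP (ULift.{u} ℚ) 0 := inferInstance
  exact CharP.charP_to_charZero (ULift.{u} ℚ)

/-- **[GvBLSW 2007, Prop. 2] — the dichotomy.**  For each degree `d` either (a) `CA_d` fails over every algebraically
closed field, of every characteristic, or (b) `CA_d` holds over every field of characteristic `0` and, for some
`N ≠ 0`, over every field of every prime characteristic `p ∤ N`. [cite: GrafVonBothmerEtAl2007, Prop. 2] -/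
theorem gvblsw_dichotomy (d : ℕ) :
    (∀ (F : Type u) [Field F] [IsAlgClosed F], ¬ HoldsInDegree F d) ∨
    ((∀ (K : Type u) [Field K] [CharZero K], HoldsInDegree K d) ∧
      ∃ N : ℕ, N ≠ 0 ∧ ∀ p : ℕ, p.Prime → ¬ p ∣ N →
        ∀ (F : Type u) [Field F] [CharP F p], HoldsInDegree F d) := by
  haveI := charZero_uliftRat.{u}
  by_cases h : HoldsInDegree (AlgebraicClosure (ULift.{u} ℚ)) d
  · exact Or.inr ⟨fun K _ _ => holdsInDegree_of_isAlgClosed_charZero h K, exists_bound_badPrimes h⟩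
  · refine Or.inl fun F _ _ hF => h ?_
    obtain ⟨p, hp⟩ := CharP.exists F
    rcases CharP.char_is_prime_or_zero F p with hprime | rfl
    · haveI : Fact p.Prime := ⟨hprime⟩
      exact holdsInDegree_of_charP_of_charZero p (fun F' _ _ => holdsInDegree_of_isAlgClosed_charP p hF F')
        (AlgebraicClosure (ULift.{u} ℚ))
    · haveI : CharZero F := CharP.charP_to_charZero F
      exact holdsInDegree_of_isAlgClosed_charZero hF (AlgebraicClosure (ULift.{u} ℚ))

/-- **The characteristic-`0` Casas-Alvero statement in degree `d`, four equivalent forms** [GvBLSW 2007, Prop. 2 with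
its proof]: (1) over every field of characteristic `0`; (2) over every field of SOME prime characteristic; (3) over
every field of every prime characteristic outside the divisors of some `N ≠ 0`; (4) finitely many bad primes.
[cite: GrafVonBothmerEtAl2007, Prop. 2] [cite: CastryckLaterveerOunaies2012, Thm. 3] -/
theorem holdsInDegree_charZero_tfae (d : ℕ) : List.TFAE
    [ ∀ (K : Type u) [Field K] [CharZero K], HoldsInDegree K d,
      ∃ p : ℕ, p.Prime ∧ ∀ (F : Type u) [Field F] [CharP F p], HoldsInDegree F d,
      ∃ N : ℕ, N ≠ 0 ∧ ∀ p : ℕ, p.Prime → ¬ p ∣ N → ∀ (F : Type u) [Field F] [CharP F p], HoldsInDegree F d,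
      {p : ℕ | p.Prime ∧ ∃ (F : Type u) (_ : Field F) (_ : CharP F p), ¬ HoldsInDegree F d}.Finite ] := by
  classical
  haveI := charZero_uliftRat.{u}
  tfae_have 1 → 3 := fun h => exists_bound_badPrimes (h (AlgebraicClosure (ULift.{u} ℚ)))
  tfae_have 3 → 2 := by
    rintro ⟨N, hN, hgood⟩
    obtain ⟨p, hNp, hp⟩ := Nat.exists_infinite_primes (N + 1)
    exact ⟨p, hp, hgood p hp fun hdvd => by have := Nat.le_of_dvd (Nat.pos_of_ne_zero hN) hdvd; omega⟩
  tfae_have 2 → 1 := by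
    rintro ⟨p, hp, h⟩ K _ _
    haveI : Fact p.Prime := ⟨hp⟩
    exact holdsInDegree_of_charP_of_charZero p (fun F _ _ => h F) K
  tfae_have 3 → 4 := by
    rintro ⟨N, hN, hgood⟩
    refine (Finset.finite_toSet N.primeFactors).subset ?_
    rintro p ⟨hp, F, hF, hFp, hbad⟩
    simp only [Finset.mem_coe, Nat.mem_primeFactors]
    exact ⟨hp, by_contra fun hpN => hbad (hgood p hp hpN F), hN⟩
  tfae_have 4 → 3 := by
    intro hfin
    refine ⟨∏ p ∈ hfin.toFinset, p, ?_, ?_⟩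
    · exact Finset.prod_ne_zero_iff.mpr fun p hp => (hfin.mem_toFinset.mp hp).1.ne_zero
    · intro p hp hpN F _ _
      by_contra hbad
      exact hpN (Finset.dvd_prod_of_mem _ (hfin.mem_toFinset.mpr ⟨hp, F, ‹_›, ‹_›, hbad⟩))
  tfae_finish

/-- In particular: `CA_d` over every field of characteristic `0` iff `CA_d` over every field of SOME prime
characteristic. [cite: GrafVonBothmerEtAl2007, Prop. 2] -/
theorem holdsInDegree_charZero_iff_exists_prime (d : ℕ) :
    (∀ (K : Type u) [Field K] [CharZero K], HoldsInDegree K d) ↔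
      ∃ p : ℕ, p.Prime ∧ ∀ (F : Type u) [Field F] [CharP F p], HoldsInDegree F d :=
  (holdsInDegree_charZero_tfae.{u} d).out 0 1

/-- … iff the set of bad primes of degree `d` is finite. [cite: GrafVonBothmerEtAl2007, Prop. 2]
[cite: CastryckLaterveerOunaies2012, §1] -/
theorem holdsInDegree_charZero_iff_finite_badPrimes (d : ℕ) :
    (∀ (K : Type u) [Field K] [CharZero K], HoldsInDegree K d) ↔
      {p : ℕ | p.Prime ∧ ∃ (F : Type u) (_ : Field F) (_ : CharP F p), ¬ HoldsInDegree F d}.Finite :=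
  (holdsInDegree_charZero_tfae.{u} d).out 0 3

end Literature.Algebra.Polynomial.CasasAlvero
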